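import Mathlib.Algebra.CharP.Lemmas
import Mathlib.RingTheory.Ideal.Prime
import Mathlib.RingTheory.Ideal.Span
import Mathlib.RingTheory.Localization.FractionRing
import Mathlib.RingTheory.UniqueFactorizationDomain.Multiplicity
import Mathlib.Order.Lattice.Nat
import HarnessLib

/-!
# The Swan conductor of an Artin–Schreier class at a prime divisor (Kato 1989, rank 1, `s = 1`)

Topic: `Literature/AlgebraicGeometry/Ramification` (new topic, definition request
`defn-KatoCleanRamification`, Stage 1). This file is the LOCAL, degree-`p` layer of K. Kato's
ramification theory of characters with imperfect residue fields: the Brylinski–Kato filtration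
and the Swan conductor of an Artin–Schreier class at one prime divisor. The refined Swan
conductor and Kato's CLEANLINESS along a strict normal crossings divisor are built on top of it
in `KatoCleanRamification.lean`; the module of logarithmic differentials they live in is
`LogDifferentials.lean`.

## The printed definitions (Kato 1989 = [K1]; recalled verbatim in Yatagawa 2022, §1.1)

Let `K` be a (complete, Yatagawa; henselian suffices, Abbes–Saito 2011 §1.10) discrete valuation
field of characteristic `p > 0` with normalized valuation `ord_K`, arbitrary residue field.
* Brylinski–Kato filtration ([K1] §2; Yatagawa 2022 Def. 1.1 (2)): on the Witt vectors
  `W_s(K)`, `fil_n W_s(K) = {a | ord_K(a) ≥ -n}` where `ord_K(a_{s-1},…,a_0) = min_i p^i ord_K(a_i)`;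
  for `s = 1`: `fil_n K = {a ∈ K | ord_K(a) ≥ -n} = 𝔪_K^{-n}`.
* Artin–Schreier–Witt ([K1]; Yatagawa (1.3)): `0 → W_s(𝔽_p) → W_s(K) —F-1→ W_s(K) —δ_s→
  H¹(K, ℤ/p^s) → 0`; for `s = 1`, `H¹(K, ℤ/p) = K/℘(K)`, `℘(g) = g^p - g`, the class of `f ∈ K`
  being the `ℤ/p`-torsor `z^p - z = f`.
* `fil_n H¹(K, ℚ/ℤ) = H¹(K,ℚ/ℤ)' + ⋃_s δ_s(fil_n W_s(K))` ([K1] Cor. (2.5), Thm. (3.2)(1);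
  Yatagawa Def. 1.3) and the **Swan conductor** `sw(χ) = min {n ≥ 0 | χ ∈ fil_n H¹}`
  ([K1] Def. (2.2); Yatagawa Def. 1.5 (1)). For a class of order `p`, i.e. `χ = δ₁(f)`:
  `sw(χ) = min {n ≥ 0 | f ∈ 𝔪_K^{-n} + ℘(K)}` — the least order of pole of a representative.

## Rendering (element level; what is and is not literal)

Kato's theory is applied (Kato 1994 §3; Yatagawa 2022 §1.2, Conventions) at the generic point
`𝔭ᵢ` of a component `Dᵢ` of a divisor on a regular scheme `X`, to `Kᵢ = Frac(𝒪^_{X,𝔭ᵢ})` (or the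
henselization). We render the `s = 1` case for an element `f` of a field `K` receiving a ring
`A` (think `A = 𝒪_{X,x}`, `K` = the function field) and an element `t ∈ A` cutting out the prime
divisor (think a branch `Dᵢ = V(t)` at `x`): `PoleOrderLE t n f` says `s · tⁿ · f ∈ A` for some
`s ∈ A ∖ (t)`, i.e. `f ∈ t^{-n} · A_{(t)}`; when `A_{(t)}` is a discrete valuation ring of `K`
with uniformizer `t` (the case of a prime divisor on a locally Noetherian regular, or normal,
scheme) this is literally `ord_t(f) ≥ -n`, i.e. `f ∈ fil_n` for the `t`-adic valuation of `K`.
`swanConductor p t f` is then `min {n | ∃ g, f - ℘(g) ∈ fil_n}` computed in `K` itself rather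
than in its completion `K̂ = Kᵢ`. THE TWO MINIMA AGREE (so this is Kato's `sw(χ|_{Kᵢ})` for the
class `χ` of `f`): if `f ∈ K` has `ord(f) = -m < 0` and `ord(f - ℘(ĝ)) > -m` for some `ĝ ∈ K̂`,
then necessarily `p · ord(ĝ) = -m` (otherwise the pole orders cannot cancel), and any `g ∈ K`
with `ord(ĝ - g) > -m/p` (density of `K` in `K̂`) has `ord(℘(ĝ) - ℘(g)) =
ord((ĝ-g)^p - (ĝ-g)) > -m`, whence `ord(f - ℘(g)) > -m`; induction on `m`. (Equivalently: the
graded pieces `gr_n H¹` inject into `gr_n Ω¹_K` by [K1] Thm. (3.2) = Yatagawa Prop. 1.8 (1), and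
`gr_n` of `K` and of `K̂` coincide.) This comparison is recorded here in prose only.

## Content

* `artinSchreier p : R → R`, `℘(a) = a^p - a`, with `artinSchreier_add/neg/sub/zero` in
  characteristic `p`.
* `PoleOrderLE t n f` and its API (`mono`, `zero_right`, `of_algebraMap`, `add`, `smul`,
  `exists_poleOrderLE` for fraction fields of Noetherian domains).
* `swanConductor p t f : ℕ` and its API: `swanConductor_le`, `exists_poleOrderLE_swanConductor`
  (the minimum is attained), `not_poleOrderLE_of_lt_swanConductor`, `swanConductor_eq_zero_iff`,
  `swanConductor_sub_artinSchreier` (it only depends on the Artin–Schreier class).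

## What is NOT here

Witt vectors of length `s ≥ 2` (classes of order `p^s`), the non-logarithmic filtration `fil'`
and the total dimension `dt` (Matsuda, Abbes–Saito, Yatagawa Def. 1.1 (3), 1.5 (2)), and the
upper-numbering ramification groups; none is needed by the requesting route, whose wild inertia
is filtered by elementary abelian `p`-groups (Artin–Schreier layers).

## Sources

* K. Kato, *Swan conductors for characters of degree one in the imperfect residue field case*,
  Contemp. Math. 83 (1989), §2 (Def. (2.2), Cor. (2.5)), Thm. (3.2). [Kato1989] (cite-only here;
  statements taken from the verbatim recollection in Yatagawa 2022 §1.1.)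
* Y. Yatagawa, *Singular support and characteristic cycle of a rank one sheaf in codimension
  two*, arXiv:2206.02989 (2022), Def. 1.1, (1.3), Def. 1.3, Def. 1.5, Conventions p. 5.
  [Yatagawa2022]
* A. Abbes, T. Saito, *Ramification and cleanliness*, Tohoku Math. J. 63 (2011), §1.10–1.11.
  [AbbesSaito2011]
-/

namespace Literature.AlgebraicGeometry.Ramification

universe u v

/-! ## The Artin–Schreier operator -/

section ArtinSchreier

variable {R : Type u} [CommRing R]

/-- The **Artin–Schreier operator** `℘(a) = a^p - a` (`= (F - 1)(a)`, `F` the Frobenius) on a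
commutative ring; in characteristic `p` its cokernel `R/℘(R)` is `H¹_ét(Spec R, ℤ/p)` for `R`
with `H¹(Spec R, 𝒪) = 0` (e.g. `R` a field, or any ring: affine schemes), the class of `f` being
the `ℤ/p`-torsor `z^p - z = f` (Yatagawa 2022 (1.3) with `s = 1`). [folklore] -/
def artinSchreier (p : ℕ) (a : R) : R :=
  a ^ p - a

/-- Unfolding lemma for `artinSchreier`. [folklore] -/
theorem artinSchreier_def (p : ℕ) (a : R) : artinSchreier p a = a ^ p - a :=
  rfl

/-- `℘(0) = 0` (for `p ≠ 0`). [folklore] -/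
@[simp]
theorem artinSchreier_zero {p : ℕ} (hp : p ≠ 0) : artinSchreier p (0 : R) = 0 := by
  simp [artinSchreier, zero_pow hp]

/-- `℘(1) = 0`. [folklore] -/
@[simp]
theorem artinSchreier_one (p : ℕ) : artinSchreier p (1 : R) = 0 := by
  simp [artinSchreier]

variable (p : ℕ) [Fact p.Prime] [CharP R p]

/-- `℘` is additive in characteristic `p`. [folklore] -/
theorem artinSchreier_add (a b : R) :
    artinSchreier p (a + b) = artinSchreier p a + artinSchreier p b := by
  simp only [artinSchreier, add_pow_char]
  ring

/-- `℘(-a) = -℘(a)` in characteristic `p`. [folklore] -/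
theorem artinSchreier_neg (a : R) : artinSchreier p (-a) = -artinSchreier p a := by
  have h : artinSchreier p (-a) + artinSchreier p a = 0 := by
    rw [← artinSchreier_add p, neg_add_cancel, artinSchreier_zero (Fact.out : p.Prime).ne_zero]
  exact eq_neg_of_add_eq_zero_left h

/-- `℘` is compatible with subtraction in characteristic `p`. [folklore] -/
theorem artinSchreier_sub (a b : R) :
    artinSchreier p (a - b) = artinSchreier p a - artinSchreier p b := by
  rw [sub_eq_add_neg, artinSchreier_add p, artinSchreier_neg p, ← sub_eq_add_neg]

/-- Elements of the prime field are killed by `℘` (`n^p = n`). [folklore] -/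
@[simp]
theorem artinSchreier_natCast (n : ℕ) : artinSchreier p (n : R) = 0 := by
  induction n with
  | zero => simp [artinSchreier_zero (Fact.out : p.Prime).ne_zero]
  | succ n ih => rw [Nat.cast_succ, artinSchreier_add p, ih, artinSchreier_one, zero_add]

end ArtinSchreier

/-! ## Pole order along a prime divisor -/

section PoleOrder

variable {A : Type u} [CommRing A] {K : Type v} [CommRing K] [Algebra A K]

/-- **Pole of order at most `n` along `V(t)`.** For `t ∈ A` and `f ∈ K` (`A → K`, think
`A = 𝒪_{X,x} → K(X)`): there are `s ∈ A ∖ (t)` and `a ∈ A` with `s · tⁿ · f = a` in `K`, i.e.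
`f ∈ t⁻ⁿ · A_{(t)}`. When `A_{(t)}` is a discrete valuation ring of `K` with uniformizer `t` this
is `ord_t(f) ≥ -n`, membership in the `s = 1` Brylinski–Kato piece `fil_n = 𝔪^{-n}` of the
`t`-adic valuation (Yatagawa 2022 Def. 1.1 (2) with `s = 1`; Kato 1989 §2).
[cite: Yatagawa2022, Def. 1.1 (2)] -/
def PoleOrderLE (t : A) (n : ℕ) (f : K) : Prop :=
  ∃ s a : A, s ∉ Ideal.span {t} ∧ algebraMap A K (s * t ^ n) * f = algebraMap A K a

namespace PoleOrderLE

variable {t : A} {n m : ℕ} {f g : K}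

/-- Unfolding lemma. [folklore] -/
theorem iff : PoleOrderLE t n f ↔
    ∃ s a : A, s ∉ Ideal.span {t} ∧ algebraMap A K (s * t ^ n) * f = algebraMap A K a :=
  Iff.rfl

/-- A pole of order `≤ n` is a pole of order `≤ m` for `n ≤ m`. [folklore] -/
theorem mono (h : PoleOrderLE t n f) (hnm : n ≤ m) : PoleOrderLE t m f := by
  obtain ⟨s, a, hs, h⟩ := h
  refine ⟨s, t ^ (m - n) * a, hs, ?_⟩
  have : s * t ^ m = t ^ (m - n) * (s * t ^ n) := by
    calc s * t ^ m = s * (t ^ (m - n) * t ^ n) := by rw [← pow_add, Nat.sub_add_cancel hnm]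
      _ = t ^ (m - n) * (s * t ^ n) := by ring
  rw [this, map_mul, mul_assoc, h, ← map_mul]

/-- Regular elements have no pole: `PoleOrderLE t 0 (algebraMap A K a)`, provided `(t)` is a
proper ideal. [folklore] -/
theorem of_algebraMap (ht : Ideal.span {t} ≠ ⊤) (a : A) : PoleOrderLE t 0 (algebraMap A K a) :=
  ⟨1, a, fun h => ht ((Ideal.eq_top_iff_one _).mpr h), by simp⟩

/-- `0` has a pole of order `≤ n` for every `n` (given `(t) ≠ A`). [folklore] -/
theorem zero_right (ht : Ideal.span {t} ≠ ⊤) (n : ℕ) : PoleOrderLE t n (0 : K) :=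
  ⟨1, 0, fun h => ht ((Ideal.eq_top_iff_one _).mpr h), by simp⟩

/-- Multiplication by a regular function does not increase the pole order. [folklore] -/
theorem smul (h : PoleOrderLE t n f) (b : A) : PoleOrderLE t n (algebraMap A K b * f) := by
  obtain ⟨s, a, hs, h⟩ := h
  refine ⟨s, b * a, hs, ?_⟩
  rw [map_mul _ b a, ← h]; ring

/-- Poles of order `≤ n` along a PRIME divisor `V(t)` form an additive subgroup: closure under
addition (the denominators `s₁, s₂ ∉ (t)` multiply to `s₁ s₂ ∉ (t)` because `(t)` is prime).
[folklore] -/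
theorem add (ht : Ideal.IsPrime (Ideal.span {t})) (hf : PoleOrderLE t n f) (hg : PoleOrderLE t n g) :
    PoleOrderLE t n (f + g) := by
  obtain ⟨s₁, a₁, hs₁, h₁⟩ := hf
  obtain ⟨s₂, a₂, hs₂, h₂⟩ := hg
  refine ⟨s₁ * s₂, s₂ * a₁ + s₁ * a₂, fun h => (ht.mem_or_mem h).elim hs₁ hs₂, ?_⟩
  have e : s₁ * s₂ * t ^ n = s₂ * (s₁ * t ^ n) := by ring
  have e' : s₁ * s₂ * t ^ n = s₁ * (s₂ * t ^ n) := by ring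
  rw [mul_add, map_add]
  congr 1
  · rw [e, map_mul, mul_assoc, h₁, ← map_mul]
  · rw [e', map_mul, mul_assoc, h₂, ← map_mul]

/-- Negation preserves the pole order. [folklore] -/
theorem neg (h : PoleOrderLE t n f) : PoleOrderLE t n (-f) := by
  obtain ⟨s, a, hs, h⟩ := h
  exact ⟨s, -a, hs, by rw [mul_neg, h, map_neg]⟩

/-- Subtraction preserves the pole order along a prime divisor. [folklore] -/
theorem sub (ht : Ideal.IsPrime (Ideal.span {t})) (hf : PoleOrderLE t n f) (hg : PoleOrderLE t n g) :
    PoleOrderLE t n (f - g) := by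
  rw [sub_eq_add_neg]; exact hf.add ht hg.neg

end PoleOrderLE

/-- **Every element of the function field has some pole order** along `V(t)`, `t` a non-unit
of a Noetherian (more generally: well-founded for divisibility) domain `A` with fraction field
`K`: write `f = a/b`, `b = tᵐ s` with `t ∤ s` (finite multiplicity). [folklore] -/
theorem exists_poleOrderLE [IsDomain A] [WfDvdMonoid A] {K : Type v} [Field K] [Algebra A K]
    [IsFractionRing A K] {t : A} (ht : ¬IsUnit t) (f : K) : ∃ n, PoleOrderLE t n f := by
  obtain ⟨a, b, hb, rfl⟩ := IsFractionRing.div_surjective (A := A) f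
  have hb0 : b ≠ 0 := nonZeroDivisors.ne_zero hb
  have hfin : FiniteMultiplicity t b := FiniteMultiplicity.of_not_isUnit ht hb0
  obtain ⟨s, hbs⟩ := pow_multiplicity_dvd t b
  have hts : ¬t ∣ s := by
    intro hd
    apply hfin.not_pow_dvd_of_multiplicity_lt (Nat.lt_succ_self _)
    rw [pow_succ]
    exact (mul_dvd_mul_left _ hd).trans (dvd_of_eq hbs.symm)
  refine ⟨multiplicity t b, s, a, by rwa [Ideal.mem_span_singleton], ?_⟩
  have hbK : algebraMap A K b ≠ 0 :=
    fun h => hb0 ((IsFractionRing.injective A K) (by rw [h, map_zero]))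
  rw [mul_comm s, ← hbs, mul_div_cancel₀ _ hbK]

/-! ## The Swan conductor of an Artin–Schreier class -/

section Swan

variable (p : ℕ) (t : A) (f : K)

/-- **Kato's Swan conductor** of the Artin–Schreier class of `f ∈ K` at the prime divisor `V(t)`
(rank 1, classes of order `p`): the least `n ≥ 0` such that `f - ℘(g)` has a pole of order
`≤ n` along `V(t)` for some `g ∈ K`, i.e. the least `n` with `χ_f ∈ fil_n H¹ = δ₁(𝔪^{-n})`
(Kato 1989 Def. (2.2) with `s = 1`, recalled as Yatagawa 2022 Def. 1.5 (1); computed in `K`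
instead of its `t`-adic completion, which gives the same number — module docstring). `sw = 0`
iff the class is tame (unramified or tamely ramified) at `V(t)` (Yatagawa 2022 Rem. 1.6 (3)).
Junk value `0` if `f` has no representative of finite pole order (impossible for `K` the
fraction field of a Noetherian domain `A ∌ t⁻¹`, `exists_poleOrderLE`).
[cite: Kato1989, Def. (2.2)] -/
noncomputable def swanConductor : ℕ :=
  sInf {n : ℕ | ∃ g : K, PoleOrderLE t n (f - artinSchreier p g)}

variable {p t f}

/-- A representative with a pole of order `≤ n` bounds the Swan conductor by `n`. [folklore] -/
theorem swanConductor_le {n : ℕ} (g : K) (h : PoleOrderLE t n (f - artinSchreier p g)) :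
    swanConductor p t f ≤ n :=
  Nat.sInf_le ⟨g, h⟩

/-- If `f` itself has a pole of order `≤ n` then `sw ≤ n` (take `g = 0`; needs `p ≠ 0`).
[folklore] -/
theorem swanConductor_le_of_poleOrderLE (hp : p ≠ 0) {n : ℕ} (h : PoleOrderLE t n f) :
    swanConductor p t f ≤ n :=
  swanConductor_le 0 (by rwa [artinSchreier_zero hp, sub_zero])

/-- **The minimum is attained**: some Artin–Schreier translate of `f` has a pole of order exactly
`≤ sw` along `V(t)`, as soon as some translate has finite pole order. [folklore] -/
theorem exists_poleOrderLE_swanConductor (h : ∃ (n : ℕ) (g : K), PoleOrderLE t n (f - artinSchreier p g)) :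
    ∃ g : K, PoleOrderLE t (swanConductor p t f) (f - artinSchreier p g) := by
  obtain ⟨n, g, hg⟩ := h
  exact Nat.sInf_mem (s := {n : ℕ | ∃ g : K, PoleOrderLE t n (f - artinSchreier p g)}) ⟨n, g, hg⟩

/-- In the fraction field of a Noetherian domain the minimum defining `sw` is attained.
[folklore] -/
theorem exists_poleOrderLE_swanConductor_of_isFractionRing [IsDomain A] [WfDvdMonoid A]
    {K : Type v} [Field K] [Algebra A K] [IsFractionRing A K] {p : ℕ} (hp : p ≠ 0) {t : A}
    (ht : ¬IsUnit t) (f : K) :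
    ∃ g : K, PoleOrderLE t (swanConductor p t f) (f - artinSchreier p g) := by
  obtain ⟨n, hn⟩ := exists_poleOrderLE ht f
  exact exists_poleOrderLE_swanConductor ⟨n, 0, by rwa [artinSchreier_zero hp, sub_zero]⟩

/-- **Minimality**: no Artin–Schreier translate of `f` has a pole of order `< sw`. [folklore] -/
theorem not_poleOrderLE_of_lt_swanConductor {m : ℕ} (hm : m < swanConductor p t f) (g : K) :
    ¬PoleOrderLE t m (f - artinSchreier p g) := fun h =>
  Nat.notMem_of_lt_sInf (s := {n : ℕ | ∃ g : K, PoleOrderLE t n (f - artinSchreier p g)}) hm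
    ⟨g, h⟩

/-- `sw = 0` iff some translate of `f` is regular at `V(t)` (the tame case), or — junk case — no
translate has finite pole order. [folklore] -/
theorem swanConductor_eq_zero_iff : swanConductor p t f = 0 ↔
    (∃ g : K, PoleOrderLE t 0 (f - artinSchreier p g)) ∨
      ∀ (n : ℕ) (g : K), ¬PoleOrderLE t n (f - artinSchreier p g) := by
  rw [swanConductor, Nat.sInf_eq_zero]
  refine or_congr Iff.rfl ⟨fun h n g hg => ?_, fun h => ?_⟩
  · have : n ∈ {n : ℕ | ∃ g : K, PoleOrderLE t n (f - artinSchreier p g)} := ⟨g, hg⟩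
    rw [h] at this
    exact this
  · exact Set.eq_empty_iff_forall_notMem.mpr fun n ⟨g, hg⟩ => h n g hg

/-- A class with a regular representative is tame: `sw(a) = 0` for `a ∈ A` (and `(t) ≠ A`,
`p ≠ 0`). [folklore] -/
theorem swanConductor_algebraMap (hp : p ≠ 0) (ht : Ideal.span {t} ≠ ⊤) (a : A) :
    swanConductor p t (algebraMap A K a) = 0 :=
  Nat.eq_zero_of_le_zero (swanConductor_le_of_poleOrderLE hp (PoleOrderLE.of_algebraMap ht a))

/-- **The Swan conductor is an invariant of the Artin–Schreier class**: `sw(f - ℘(g)) = sw(f)`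
(in characteristic `p`, where `℘` is additive). [folklore] -/
theorem swanConductor_sub_artinSchreier {K : Type v} [CommRing K] [Algebra A K] (p : ℕ)
    [Fact p.Prime] [CharP K p] (t : A) (f g : K) :
    swanConductor p t (f - artinSchreier p g) = swanConductor p t f := by
  unfold swanConductor
  congr 1
  ext n
  constructor
  · rintro ⟨g', h⟩
    exact ⟨g + g', by rwa [artinSchreier_add p, ← sub_sub]⟩
  · rintro ⟨g', h⟩
    exact ⟨g' - g, by rwa [artinSchreier_sub p, sub_sub, add_sub_cancel]⟩

end Swan

end PoleOrder

end Literature.AlgebraicGeometry.Ramification
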